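import Summits.CriticalPhenomena.CardyFormulaZ2.Theorems.CardyBoundaryCoulombGasHalfPlaneMarkDensityLawSelfDualityExact

/-!
# `HalfPlaneMarkDensityLaw` (crux stmt-CriticalPhenomena-5661), line `Sketch`, cycle 2 (gap closing):
# stub `stub_notCross_erase` (G1) — erasing the edges left of the source arc

The lattice half-plane is `H = ℤ × ℕ` (`halfPlane = {v | 0 ≤ v 1}`), the source arc is
`A = [α',−S] × {0}` (`rowIcc α' (-S)`) and the target arc is `C = [1,X] × {0}` (`rowIcc 1 X`).
Given a configuration `ω` NOT joining `A` to `C` inside `H`, close every edge having an endpoint `w`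
with `w 0 < α'`; the smaller configuration `ω̃ = ω \ {e | ∃ w ∈ e, w 0 < α'}` does not join the RAY
`(−∞,−S] × {0}` to `C` inside `H`.

Proof: if `ω̃` joins a ray vertex `u` (`u 1 = 0`, `u 0 ≤ −S`) to some `r ∈ C` inside `H`, then either
`α' ≤ u 0`, so that `u ∈ A` and, `openConnIn` being increasing in the configuration
(`isUpperSet_openConnIn`) and `ω̃ ⊆ ω`, the configuration `ω` joins `A` to `C` — excluded; or
`u 0 < α'`, in which case `u` is isolated in the open graph of `ω̃` (every edge at `u` has been
erased), so `u = r`, impossible since `u 0 ≤ −S < 1 ≤ r 0`.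
-/

noncomputable section

namespace Summit.CriticalPhenomena.CardyFormulaZ2.Cruxes.HalfPlaneMarkDensityLaw.SketchLine

open Literature.Probability.Percolation Literature.Probability.LatticeModels
open Literature.Probability.Percolation.Z2HalfPlane (leg Far faceBox oneArm)
open MeasureTheory Filter Set SimpleGraph
open scoped Topology
open Summit.CriticalPhenomena.CardyFormulaZ2.Theorems.HalfPlaneMarkDensityLaw.Negative

namespace GapClose

/-- In the configuration `ω \ {e | ∃ w ∈ e, w 0 < α'}` (all edges with an endpoint in `{x₀ < α'}`
erased) a vertex `u` with `u 0 < α'` is isolated: it is joined inside `S` only to itself. [folklore] -/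
theorem eq_of_mem_openConnIn_erase {ω : BondConfig (Site 2)} {α' : ℤ} {S : Set (Site 2)}
    {u r : Site 2} (hu : u 0 < α') (h : ω \ {e | ∃ w ∈ e, w 0 < α'} ∈ openConnIn S u r) :
    u = r := by
  obtain ⟨hu', hr', ⟨p⟩⟩ := h
  by_contra hne
  -- the first step of an open walk from `u` would be an erased edge
  have hadj := (openGraph_adj _ _ _).1
    (SimpleGraph.induce_adj.1 (p.adj_snd (p.not_nil_of_ne fun h => hne (congrArg Subtype.val h))))
  exact hadj.1.2 ⟨u, Sym2.mem_mk_left _ _, hu⟩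

/-- **G1 (deterministic).** Closing the edges with an endpoint left of the source arc, a configuration
not joining `[α',−S] × {0}` to `[1,X] × {0}` inside `H = ℤ × ℕ` does not join the ray `(−∞,−S] × {0}`
to `[1,X] × {0}` inside `H`: a joined ray vertex `u` with `u 0 < α'` is isolated in the erased
configuration (`eq_of_mem_openConnIn_erase`), and one with `α' ≤ u 0` lies in the source arc, the
crossing event being increasing (`isUpperSet_openConnIn`). [folklore] -/
theorem stub_notCross_erase :
    ∀ (ω : BondConfig (Site 2)) (α' S X : ℤ), α' ≤ -S → -S < 1 →
      ω ∉ openCrossing halfPlane (rowIcc α' (-S)) (rowIcc 1 X) →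
      ω \ {e | ∃ w ∈ e, w 0 < α'} ∉
        openCrossing halfPlane {v : Site 2 | v 1 = 0 ∧ v 0 ≤ -S} (rowIcc 1 X) := by
  intro ω α' S X _hα hS hω hmem
  obtain ⟨u, ⟨hu1, hu0⟩, r, hr, hconn⟩ := mem_openCrossing_iff.1 hmem
  rcases lt_or_ge (u 0) α' with hlt | hle
  · -- `u` is isolated in the erased configuration, hence `u = r`: impossible
    have hur : u = r := eq_of_mem_openConnIn_erase hlt hconn
    subst hur
    simp only [rowIcc, Set.mem_setOf_eq] at hr
    omega
  · -- `u` lies in the source arc and `ω̃ ⊆ ω`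
    exact hω ⟨u, ⟨hu1, hle, hu0⟩, r, hr, isUpperSet_openConnIn _ _ _ Set.sdiff_subset hconn⟩

end GapClose

end Summit.CriticalPhenomena.CardyFormulaZ2.Cruxes.HalfPlaneMarkDensityLaw.SketchLine
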